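import Literature.Analysis.FluidPDE.KNSSThm53OfWindow
import Literature.Analysis.FluidPDE.GigaMiura2011PlanarVorticityLiouvilleHolds
import Literature.Analysis.FluidPDE.SteadyDSolutionAsymptotics
import Literature.Analysis.FluidPDE.SteadyLiouvilleNineHalvesProofs
import HarnessLib

/-!
# Negative knowledge for the crux `ConeDesingularisation` (stmt-AnomalousDissipation-19034, route PointSink):
# IV. The axisymmetric swirl-free sub-case of the conclusion is EMPTY

Supports stmt-AnomalousDissipation-19034 (`ConeDesingularisation`, unconditionally equivalent to the support
node `CascadeSoliton` by `coneDesingularisation_iff_cascadeSoliton`); nothing here asserts a Theses decl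
positively, and nothing here bears on the zeroth law itself (the route is shelved as a REFUTATION TARGET —
a bet against the Liouville conjecture for steady `D`-solutions; this file shrinks the target).

A *cascade soliton* is a smooth steady solution `(Q, P)` of unforced unit-viscosity Navier–Stokes on `ℝ³`
with the `L²`-mass envelope `∫_{B_R}|Q|² ≤ C R^{5/3}`, finite NON-ZERO dissipation `0 < ∫|∇Q|² < ∞` and a
discretely self-similar far field. This file decides the sub-case in which the witness `Q` is AXISYMMETRIC
(about the `x₂`-axis, `IsAxisymmetric`) and SWIRL-FREE (`HasNoSwirl`, `Γ = x₀Q₁ − x₁Q₀ ≡ 0`) — the one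
symmetry class of steady flows on `ℝ³` in which the Liouville problem is SETTLED in print
(Koch–Nadirashvili–Seregin–Šverák 2009, Thm 5.2, bounded ancient solutions, PROVED in the tree:
`KNSS2009_liouville_axisymmetric_no_swirl_holds`; Korobkov–Pileckas–Russo 2015 for all `D`-solutions, the
named fact `KorobkovPileckasRusso2015_liouville_noSwirl`):

* `eq_const_smul_eZ_of_steady_noSwirl_bounded` — KNSS Thm 5.2, steady case (kernel-checked from the tree's
  proof of Thm 5.2): a BOUNDED axisymmetric swirl-free steady classical solution of unforced NS (`ν = 1`)
  on `ℝ³` is a constant `b e_z` (restrict the time-constant solution to `(−∞, 0)`; it is a bounded weak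
  solution in the sense of KNSS §4 (ii) because the zero force annihilates every test; Thm 5.2 gives
  `Q = b(t) e_z` a.e. in `x` for a.e. `t`; continuity upgrades a.e. to everywhere).
* `not_hasNoSwirl_of_steady_bounded` / `…_of_steady_tendsto` — hence a steady solution with
  `0 < ∫|∇Q|²` that is axisymmetric and bounded (resp. has SOME limit at infinity) carries swirl.
* `not_hasNoSwirl_of_steady_dirichlet` — the same for every axisymmetric steady solution with finite
  Dirichlet integral, modulo Galdi's Thm X.5.1 in the form of Wang 2025, Remark 2.1
  (`wang2025_rem21_DSolution_tendsto_const`, vendored named fact: a `D`-solution tends to some constant at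
  infinity, hence is bounded).
* `not_cascadeSoliton_noSwirl_bounded` (kernel only) and `not_cascadeSoliton_noSwirl` (mod X.5.1) — the
  packaged refutations: the crux's conclusion `CascadeSoliton` with the witness additionally axisymmetric,
  swirl-free (and bounded) is FALSE; `swirl_ne_zero_of_cascadeSoliton_witness` — profile constraint for the
  construction side: every axisymmetric witness of `CascadeSoliton` swirls somewhere.

## What carries load, and what does not

The kill uses ONLY smoothness, `0 < ∫|∇Q|²`, the symmetry class and boundedness (or `∫|∇Q|² < ∞` + X.5.1).
The `R^{5/3}` envelope and the DSS far field of the crux are NOT used: in the swirl-free class the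
positivity-of-dissipation clause alone contradicts Liouville rigidity. Information for allocation: the
invading-spheres line of the crux (`Cruxes/ConeDesingularisation/Lines/birth.lean`, `Sketch.lean`) must
produce SWIRLING (or non-axisymmetric) limits — a swirl-free point-flux cone fed into it cannot converge to
a soliton (compare `FedConeFloor`, `FedConeFlux`: the fed-cone floor must come from the azimuthal
component). The case WITH swirl is the open Liouville problem (KNSS p. 10; Wang–Yang 2026, §1).

## BC5 / T3 reading (D-0033; tribunal-w seat ad-pointsink-w1, generation 5)

This is the TREE rendering of the class-restricted witness filed as evidence on the crux item by
generation 3 of the seat (`ConeDesingularisation_rung_noSwirl.lean`, evidence sha16 7f461e01c49df6e7,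
decls `…NoSwirlRung.not_cascadeSolitonNoSwirl_bounded` / `…not_cascadeSolitonNoSwirl`), re-derived here so
that it is importable and kernel-visible to `tribunal check … --witness`. Reading: in the sibling setting
"axisymmetric swirl-free steady flows on `ℝ³`" the crux's analogue is DECIDED (false: this file), while
the zeroth-law analogue for that class (steady axisymmetric swirl-free stirring on `ℝ³`, typed as
`SteadyZerothLawNoSwirlR3` in the generation-4 evidence `ZerothLawNoSwirlR3.lean`, sha16 4550f5fcb6277526)
is not a theorem in scope. It is a NEGATIVE rung (the class is a Liouville-holds class), recorded as such;
the positive model-level rung of record remains the dyadic one (`Cruxes/ConeDesingularisation/Lines/birth.lean`,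
`…DyadicRung.ConeDesingularisation_rung`), whose `S`-side analogue is decided TRUE
(`Literature.Analysis.FluidPDE.CheskidovFriedlander2009.SteadyStateAllExponents`), so neither rung
separates decidedness in the direction "C easier than S"; both are filed honestly as what they are.
-/

noncomputable section

-- `Summit.<Summit>.<Problem>`: single-conjunct summit, the duplicate namespace is mandated (CONVENTIONS §2).
set_option linter.dupNamespace false

open MeasureTheory Filter Topology Set
open Literature.Analysis.FunctionSpaces Literature.Analysis.FluidPDE

namespace Summit.AnomalousDissipation.AnomalousDissipation.Theorems.ConeDesingularisation.Negative

/-! Route-independence (lint.theses-cone): this file imports Literature only — neither the route file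
`Theses/PointSink.lean` nor its dependants; the packaged statements of §3 are the MATRIX of
`Summit.AnomalousDissipation.AnomalousDissipation.Theses.PointSink.CascadeSoliton` written out verbatim, so
that `not_cascadeSoliton_noSwirl h ⟨Q, P, hQP, haxi, hsw⟩` consumes a `CascadeSoliton` witness `hQP`
directly (and, through `coneDesingularisation_iff_cascadeSoliton` of `Negative.ConeDesingularisationFalseOf…`,
a witness of the crux). -/

/-! ## §1 KNSS Theorem 5.2, steady case -/

/-- **KNSS 2009, Theorem 5.2 — steady case.** A bounded, axisymmetric, swirl-free steady classical
solution `(Q, P)` of the unforced unit-viscosity Navier–Stokes system on `ℝ³` is a constant multiple of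
`e_z`. Proof: the time-constant pair is a classical solution on the ancient interval `(−∞, 0)`
(`IsClassicalNSSolutionOn.mono`), hence — the zero force annihilating every solenoidal test — a bounded
weak solution in the sense of KNSS §4 (ii) (`…isBoundedWeakNSSolutionOn_Iio_of_force_annihilates`);
Theorem 5.2 (`KNSS2009_liouville_axisymmetric_no_swirl_holds`, pointwise-hypotheses form `…of_pointwise`)
gives `Q =ᵐ b(t) • e_z` for a.e. `t < 0`; pick one such `t` (`volume (Iio 0) = ∞ ≠ 0`) and upgrade the
a.e. equality of continuous functions to equality (`Continuous.ae_eq_iff_eq`). [cite: KochNadirashviliSereginSverak2009, Thm 5.2 (arXiv:0709.3599 pp. 9–10)] -/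
theorem eq_const_smul_eZ_of_steady_noSwirl_bounded
    {Q : EuclideanSpace ℝ (Fin 3) → EuclideanSpace ℝ (Fin 3)} {P : EuclideanSpace ℝ (Fin 3) → ℝ}
    (hNS : IsClassicalNSSolutionOn (univ : Set ℝ) 1 (fun _ _ => 0) (fun _ => Q) (fun _ => P))
    (haxi : IsAxisymmetric Q) (hsw : HasNoSwirl Q) (hbdd : ∃ M : ℝ, ∀ x, ‖Q x‖ ≤ M) :
    ∃ b : ℝ, Q = fun _ => b • eZ := by
  -- the steady pair is an ancient classical solution on `(−∞, 0)`
  have hanc : IsClassicalNSSolutionOn (Iio (0 : ℝ)) 1 (fun _ _ => 0) (fun _ => Q) (fun _ => P) :=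
    hNS.mono (subset_univ _) isOpen_Iio.uniqueDiffOn
  obtain ⟨M, hM⟩ := hbdd
  -- … hence a bounded weak solution in the sense of KNSS §4 (ii)
  have hweak : IsBoundedWeakNSSolutionOn (Iio (0 : ℝ)) isOpen_Iio 1 (fun _ : ℝ => Q) :=
    hanc.isBoundedWeakNSSolutionOn_Iio_of_force_annihilates ⟨M, fun _ _ x => hM x⟩
      (fun _ _ φ _ _ _ => by simp)
  -- KNSS Theorem 5.2, proved in the tree
  obtain ⟨b, -, -, hb⟩ := KNSS2009_liouville_axisymmetric_no_swirl.of_pointwise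
    KNSS2009_liouville_axisymmetric_no_swirl_holds hweak (fun _ _ => haxi) (fun _ _ => hsw)
  -- pick one good time
  have hμ : volume.restrict (Iio (0 : ℝ)) ≠ 0 := by
    rw [Ne, Measure.restrict_eq_zero, Real.volume_Iio]
    exact ENNReal.top_ne_zero
  haveI : (ae (volume.restrict (Iio (0 : ℝ)))).NeBot := ae_neBot.2 hμ
  obtain ⟨t, ht⟩ := hb.exists
  -- a continuous function a.e. equal to a constant is that constant
  have hQc : Continuous Q := (hNS.contDiff_velocity (mem_univ (0 : ℝ))).continuous
  exact ⟨b t, (hQc.ae_eq_iff_eq volume continuous_const).1 ht⟩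

/-! ## §2 Steady solutions with non-zero dissipation carry swirl -/

/-- **A bounded axisymmetric steady solution with non-zero dissipation has swirl** (kernel only): if
`(Q, P)` is a steady classical solution of unforced unit-viscosity NS on `ℝ³` with `0 < ∫|∇Q|²`,
axisymmetric and bounded, then `Q` is not swirl-free — otherwise `Q` is constant
(`eq_const_smul_eZ_of_steady_noSwirl_bounded`) and `∫|∇Q|² = 0`. [folklore] -/
theorem not_hasNoSwirl_of_steady_bounded
    {Q : EuclideanSpace ℝ (Fin 3) → EuclideanSpace ℝ (Fin 3)} {P : EuclideanSpace ℝ (Fin 3) → ℝ}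
    (hNS : IsClassicalNSSolutionOn (univ : Set ℝ) 1 (fun _ _ => 0) (fun _ => Q) (fun _ => P))
    (hpos : 0 < ∫ x, frobeniusNormSq (fderiv ℝ Q x)) (haxi : IsAxisymmetric Q)
    (hbdd : ∃ M : ℝ, ∀ x, ‖Q x‖ ≤ M) : ¬ HasNoSwirl Q := by
  intro hsw
  obtain ⟨b, rfl⟩ := eq_const_smul_eZ_of_steady_noSwirl_bounded hNS haxi hsw hbdd
  simp [frobeniusNormSq_zero] at hpos

/-- **An axisymmetric steady solution with non-zero dissipation and a limit at infinity has swirl**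
(kernel only): a continuous field with a limit along `cocompact` is bounded
(`Tendsto.isCompact_insert_range_of_cocompact`), so `not_hasNoSwirl_of_steady_bounded` applies. [folklore] -/
theorem not_hasNoSwirl_of_steady_tendsto
    {Q : EuclideanSpace ℝ (Fin 3) → EuclideanSpace ℝ (Fin 3)} {P : EuclideanSpace ℝ (Fin 3) → ℝ}
    (hNS : IsClassicalNSSolutionOn (univ : Set ℝ) 1 (fun _ _ => 0) (fun _ => Q) (fun _ => P))
    (hpos : 0 < ∫ x, frobeniusNormSq (fderiv ℝ Q x)) (haxi : IsAxisymmetric Q)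
    {u₀ : EuclideanSpace ℝ (Fin 3)} (hlim : Tendsto Q (cocompact (EuclideanSpace ℝ (Fin 3))) (𝓝 u₀)) :
    ¬ HasNoSwirl Q := by
  have hQc : Continuous Q := (hNS.contDiff_velocity (mem_univ (0 : ℝ))).continuous
  obtain ⟨M, hM⟩ :=
    ((hlim.isCompact_insert_range_of_cocompact hQc).isBounded.subset (subset_insert _ _)).exists_norm_le
  exact not_hasNoSwirl_of_steady_bounded hNS hpos haxi ⟨M, fun x => hM _ (mem_range_self x)⟩

/-- **Every axisymmetric steady solution with finite non-zero Dirichlet integral has swirl, modulo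
Galdi's Thm X.5.1** (Wang 2025, Remark 2.1, vendored named fact `wang2025_rem21_DSolution_tendsto_const`:
a `D`-solution tends to some constant vector at infinity): the pair is a `D`-solution
(momentum rearranged via the Leray-profile bridge `IsClassicalNSSolutionOn.isLerayProfile_zero_of_steady`,
`Integrable ⇒ ∫⁻ ofReal < ∞` — the same six-line step as `Negative.LiouvilleReduction.isDSolution_of_cascade`,
inlined rather than imported so that this file stays route-independent, lint.theses-cone), so it has a
limit at infinity and `not_hasNoSwirl_of_steady_tendsto` applies.
Equivalently: the swirl-free case of the Liouville problem for steady `D`-solutions WITHOUT a decay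
normalisation at infinity, in the form needed by the route item. [cite: Wang2025, Remark 2.1] -/
theorem not_hasNoSwirl_of_steady_dirichlet (hrem : wang2025_rem21_DSolution_tendsto_const)
    {Q : EuclideanSpace ℝ (Fin 3) → EuclideanSpace ℝ (Fin 3)} {P : EuclideanSpace ℝ (Fin 3) → ℝ}
    (hNS : IsClassicalNSSolutionOn (univ : Set ℝ) 1 (fun _ _ => 0) (fun _ => Q) (fun _ => P))
    (hInt : Integrable (fun x => frobeniusNormSq (fderiv ℝ Q x)))
    (hpos : 0 < ∫ x, frobeniusNormSq (fderiv ℝ Q x)) (haxi : IsAxisymmetric Q) : ¬ HasNoSwirl Q := by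
  have hprof := hNS.isLerayProfile_zero_of_steady
  have hD : IsDSolution 1 0 Q P :=
    ⟨{ contDiff_velocity := hprof.contDiff_velocity
       contDiff_pressure := hprof.contDiff_pressure
       momentum := fun y => by
         have := hprof.profile_eq y
         simp only [zero_smul, add_zero] at this
         simpa using this
       divFree := hprof.divFree }, hInt.lintegral_lt_top⟩
  obtain ⟨u₀, hu₀⟩ := hrem Q P hD
  exact not_hasNoSwirl_of_steady_tendsto hNS hpos haxi hu₀

/-! ## §3 The packaged refutations of the swirl-free sub-case of `CascadeSoliton` -/

/-- **No bounded axisymmetric swirl-free cascade soliton** (kernel only; the statement is the matrix of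
`Summit.AnomalousDissipation.AnomalousDissipation.Theses.PointSink.CascadeSoliton` verbatim with the three
class clauses appended). This is the class-restricted BC5/T3 witness for the crux: the conclusion of
`ConeDesingularisation` restricted to the axisymmetric swirl-free bounded class is decided (false). [folklore] -/
theorem not_cascadeSoliton_noSwirl_bounded :
    ¬ ∃ (Q : EuclideanSpace ℝ (Fin 3) → EuclideanSpace ℝ (Fin 3)) (P : EuclideanSpace ℝ (Fin 3) → ℝ),
      (Literature.Analysis.FluidPDE.IsClassicalNSSolutionOn Set.univ 1 (fun _ _ => 0) (fun _ => Q) (fun _ => P) ∧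
        (∃ C : ℝ, ∀ R : ℝ, 1 ≤ R →
          ∫ x in Metric.ball (0 : EuclideanSpace ℝ (Fin 3)) R, ‖Q x‖ ^ 2 ≤ C * R ^ (5 / 3 : ℝ)) ∧
        MeasureTheory.Integrable (fun x => Literature.Analysis.FluidPDE.frobeniusNormSq (fderiv ℝ Q x)) ∧
        0 < ∫ x, Literature.Analysis.FluidPDE.frobeniusNormSq (fderiv ℝ Q x) ∧
        ∃ (lam : ℝ) (V : EuclideanSpace ℝ (Fin 3) → EuclideanSpace ℝ (Fin 3)), 1 < lam ∧
          MeasureTheory.AEStronglyMeasurable V MeasureTheory.volume ∧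
          (∀ x : EuclideanSpace ℝ (Fin 3), x ≠ 0 → V (lam • x) = lam ^ (-(2 / 3 : ℝ)) • V x) ∧
          MeasureTheory.LocallyIntegrableOn (fun x => ‖V x‖ ^ 2) {x : EuclideanSpace ℝ (Fin 3) | x ≠ 0}
            MeasureTheory.volume ∧
          0 < ∫ x in {x : EuclideanSpace ℝ (Fin 3) | 1 < ‖x‖ ∧ ‖x‖ < lam}, ‖V x‖ ^ 2 ∧
          Filter.Tendsto (fun k : ℕ => (lam ^ k) ^ (-(5 / 3 : ℝ)) *
            ∫ x in {x : EuclideanSpace ℝ (Fin 3) | lam ^ k < ‖x‖ ∧ ‖x‖ < lam ^ (k + 1)}, ‖Q x - V x‖ ^ 2)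
            Filter.atTop (nhds 0)) ∧
      IsAxisymmetric Q ∧ HasNoSwirl Q ∧ ∃ M : ℝ, ∀ x, ‖Q x‖ ≤ M := by
  rintro ⟨Q, P, ⟨hNS, -, -, hpos, -⟩, haxi, hsw, hbdd⟩
  exact not_hasNoSwirl_of_steady_bounded hNS hpos haxi hbdd hsw

/-- **No axisymmetric swirl-free cascade soliton, modulo Galdi's Thm X.5.1** (Wang 2025, Remark 2.1 as
the hypothesis `wang2025_rem21_DSolution_tendsto_const`; the statement is the matrix of `CascadeSoliton`
verbatim with the two class clauses appended). [cite: Wang2025, Remark 2.1] -/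
theorem not_cascadeSoliton_noSwirl (hrem : wang2025_rem21_DSolution_tendsto_const) :
    ¬ ∃ (Q : EuclideanSpace ℝ (Fin 3) → EuclideanSpace ℝ (Fin 3)) (P : EuclideanSpace ℝ (Fin 3) → ℝ),
      (Literature.Analysis.FluidPDE.IsClassicalNSSolutionOn Set.univ 1 (fun _ _ => 0) (fun _ => Q) (fun _ => P) ∧
        (∃ C : ℝ, ∀ R : ℝ, 1 ≤ R →
          ∫ x in Metric.ball (0 : EuclideanSpace ℝ (Fin 3)) R, ‖Q x‖ ^ 2 ≤ C * R ^ (5 / 3 : ℝ)) ∧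
        MeasureTheory.Integrable (fun x => Literature.Analysis.FluidPDE.frobeniusNormSq (fderiv ℝ Q x)) ∧
        0 < ∫ x, Literature.Analysis.FluidPDE.frobeniusNormSq (fderiv ℝ Q x) ∧
        ∃ (lam : ℝ) (V : EuclideanSpace ℝ (Fin 3) → EuclideanSpace ℝ (Fin 3)), 1 < lam ∧
          MeasureTheory.AEStronglyMeasurable V MeasureTheory.volume ∧
          (∀ x : EuclideanSpace ℝ (Fin 3), x ≠ 0 → V (lam • x) = lam ^ (-(2 / 3 : ℝ)) • V x) ∧
          MeasureTheory.LocallyIntegrableOn (fun x => ‖V x‖ ^ 2) {x : EuclideanSpace ℝ (Fin 3) | x ≠ 0}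
            MeasureTheory.volume ∧
          0 < ∫ x in {x : EuclideanSpace ℝ (Fin 3) | 1 < ‖x‖ ∧ ‖x‖ < lam}, ‖V x‖ ^ 2 ∧
          Filter.Tendsto (fun k : ℕ => (lam ^ k) ^ (-(5 / 3 : ℝ)) *
            ∫ x in {x : EuclideanSpace ℝ (Fin 3) | lam ^ k < ‖x‖ ∧ ‖x‖ < lam ^ (k + 1)}, ‖Q x - V x‖ ^ 2)
            Filter.atTop (nhds 0)) ∧
      IsAxisymmetric Q ∧ HasNoSwirl Q := by
  rintro ⟨Q, P, ⟨hNS, -, hInt, hpos, -⟩, haxi, hsw⟩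
  exact not_hasNoSwirl_of_steady_dirichlet hrem hNS hInt hpos haxi hsw

/-- **Profile constraint for the construction side**: modulo X.5.1, every AXISYMMETRIC witness `(Q, P)`
of `CascadeSoliton` (indeed every axisymmetric steady classical unforced solution with finite non-zero
Dirichlet integral) swirls somewhere: `Γ(x) = x₀Q₁(x) − x₁Q₀(x) ≠ 0` for some `x`. [folklore] -/
theorem swirl_ne_zero_of_cascadeSoliton_witness (hrem : wang2025_rem21_DSolution_tendsto_const)
    {Q : EuclideanSpace ℝ (Fin 3) → EuclideanSpace ℝ (Fin 3)} {P : EuclideanSpace ℝ (Fin 3) → ℝ}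
    (hNS : IsClassicalNSSolutionOn (univ : Set ℝ) 1 (fun _ _ => 0) (fun _ => Q) (fun _ => P))
    (hInt : Integrable (fun x => frobeniusNormSq (fderiv ℝ Q x)))
    (hpos : 0 < ∫ x, frobeniusNormSq (fderiv ℝ Q x)) (haxi : IsAxisymmetric Q) :
    ∃ x, swirl Q x ≠ 0 := by
  by_contra h
  exact not_hasNoSwirl_of_steady_dirichlet hrem hNS hInt hpos haxi fun x => not_not.1 (not_exists.1 h x)

end Summit.AnomalousDissipation.AnomalousDissipation.Theorems.ConeDesingularisation.Negative

end
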